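import Mathlib
import Summits.NavierStokesRegularity.NavierStokesRegularity.Theorems.TaoLadderRungTwoBreakBlowupRigidityOneLinks
import HarnessLib

/-!
# `TaoLadderRungTwoBreak.BlowupRigidityOne` (stmt-NavierStokesRegularity-20206, K2(1)): the registered skeleton
  `9d85f4d387c689cd` PINNED BEHIND EXISTING ITEMS — both stubs follow from the route's `Target` (⟨20204⟩), the
  bounded inviscid Liouville item (ρ0) `NoSurvivingEternalBddOne` (⟨20451⟩) and ONE named analytic gap (a type-I
  a-priori bound for forward-surviving admissible eternal solutions); and the classification stub in its
  «Liouville-upgrade» normal form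

MODEL lattice ODEs only (Tao 2016 §4, the cell vocabulary of `RenormalisedCascadeWaves` /
`SelfSimilarCascadeBlowup` / `BoundedEternalSolutions`); nothing in this file is a statement about the
Navier–Stokes equations, and NO item is closed by it (`--supports stmt-NavierStokesRegularity-20206`).
Pure logic over the tree's predicates; sequel to `…BlowupRigidityOneLinks` (which records stubs ⇒ crux,
`Target` ⇒ crux and ⇒ `stub_eternalFromBlowup`, K1^∞_fwd(1) ⇒ `stub_eternalIsDSS`).

What is added (the stub signatures are quoted VERBATIM as hypotheses / conclusions, never defined):

* `noSurvivingEternalFwd_of_bdd_of_typeIApriori` — one spread: the bounded inviscid Liouville predicate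
  `NoSurvivingEternalBdd R 1` together with a TYPE-I A-PRIORI BOUND for forward-(S₁)-surviving admissible
  eternal solutions (spelled inline: below a threshold every such solution of an `E₂(R)` table is
  `UniformBound`) gives the unrestricted Liouville predicate `NoSurvivingEternalFwd R 1` (K1^∞_fwd(1));
* `stubEternalIsDSS_of_noSurvivingEternalBddOne_of_typeIApriori` — hence the route ITEM (ρ0)
  `NoSurvivingEternalBddOne` (stmt-…-20451) plus the type-I a-priori bound give the classification stub
  `stub_eternalIsDSS` (vacuously: its hypothesis class is empty);
* `stubs_of_target_of_noSurvivingEternalBddOne_of_typeIApriori` — **both registered stubs of the skeleton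
  follow from `Target` (⟨20204⟩) ∧ `NoSurvivingEternalBddOne` (⟨20451⟩) ∧ the type-I a-priori bound**: the
  skeleton is pinned behind two EXISTING items and one named gap, with no new object;
* `stubEternalIsDSS_iff_liouvilleUpgrade` — the classification stub is, table by table and ratio by ratio,
  the CONTRAPOSITIVE «Liouville upgrade»: wherever every (S₁)-surviving admissible DSS wave is trivial
  (K1(1) at `(α, ε₀)`), no admissible eternal solution survives forward at `a = 1` (K1^∞_fwd(1) at
  `(α, ε₀)`) — an `∃→∃` classification is a `∀→∀` rigidity transfer;
* `noSurvivingEternalFwdOne_of_stubEternalIsDSS_of_noSurvivingDSSOne` — consequently the classification stub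
  UPGRADES the rev-1 aside K1(1) `NoSurvivingDSSOne` (⟨20205⟩) to K1^∞_fwd(1) for every spread, and
  `target_of_stubs_of_noSurvivingDSSOne` — with the extraction stub this already gives the `Target`
  through `noRobustBlowupBelow_of_eternalFwd`, i.e. the route's historical `Assembly` one level down
  (without passing through the crux).

HONEST FRAMING: by-name bookkeeping for the planner (which existing items and which single analytic gap the
two active stubs sit behind); the mathematics of K2(1) — type-I renormalised compactness of a robust
blow-up, rigidity of surviving eternal solutions — is not touched; no stub, crux, rung or summit is proved.
-/

noncomputable section

-- the summit and its single sub-problem share the name (CONVENTIONS §1)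
set_option linter.dupNamespace false

namespace Summit.NavierStokesRegularity.NavierStokesRegularity.Theorems

namespace BlowupRigidityOne

open Literature.Analysis.FluidPDE Literature.Analysis.FluidPDE.TaoCascade
open Summit.NavierStokesRegularity.NavierStokesRegularity.Theses.TaoLadderRungTwoBreak

/-- **Bounded Liouville + type-I a-priori bound ⇒ unrestricted Liouville** (one spread `R`, exponent
`a = 1`): if below a threshold no `E₂(R)` table carries a UNIFORMLY BOUNDED admissible eternal solution
surviving forward (`NoSurvivingEternalBdd R 1`), and below a (possibly different) threshold every
forward-surviving admissible eternal solution of an `E₂(R)` table IS uniformly bounded (the type-I a-priori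
bound, spelled inline), then below the smaller threshold no admissible eternal solution survives forward at
all (`NoSurvivingEternalFwd R 1`). [cite: Tao2016AveragedNS, §4 Thm. 4.2 (statement shape), §6.4; cell vocabulary] -/
theorem noSurvivingEternalFwd_of_bdd_of_typeIApriori {R : ℝ} (h0 : NoSurvivingEternalBdd R 1)
    (hI : ∃ εs : ℝ, 0 < εs ∧ ∀ ε₀ : ℝ, 0 < ε₀ → ε₀ ≤ εs →
      ∀ α : (Fin 4 → Fin 4 → Fin 4 → ℤ × ℤ × ℤ → ℝ), InTableClass R α →
        ∀ W : ℤ → ℝ → Em 4, IsEternal ε₀ α W → EternalSurvivingFwd 1 ε₀ W → UniformBound W) :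
    NoSurvivingEternalFwd R 1 := by
  obtain ⟨ε₁, hε₁, H0⟩ := h0
  obtain ⟨ε₂, hε₂, HI⟩ := hI
  refine ⟨min ε₁ ε₂, lt_min hε₁ hε₂, fun ε₀ hε₀ hle α hα W hW hS => ?_⟩
  exact H0 ε₀ hε₀ (hle.trans (min_le_left _ _)) α hα W hW
    (HI ε₀ hε₀ (hle.trans (min_le_right _ _)) α hα W hW hS) hS

/-- **The route item (ρ0) `NoSurvivingEternalBddOne` (stmt-NavierStokesRegularity-20451) plus the type-I
a-priori bound give the classification stub `stub_eternalIsDSS`** (signature verbatim): under them the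
stub's hypothesis `∃ W, IsEternal ε₀ α W ∧ EternalSurvivingFwd 1 ε₀ W` is never met below the threshold
(through `noSurvivingEternalFwd_of_bdd_of_typeIApriori` and the tree's
`stubEternalIsDSS_of_noSurvivingEternalFwdOne`).
[cite: Tao2016AveragedNS, §4 Thm. 4.2 (statement shape), §6.4; cell vocabulary] -/
theorem stubEternalIsDSS_of_noSurvivingEternalBddOne_of_typeIApriori (h0 : NoSurvivingEternalBddOne)
    (hI : ∀ R : ℝ, 1 ≤ R → ∃ εs : ℝ, 0 < εs ∧ ∀ ε₀ : ℝ, 0 < ε₀ → ε₀ ≤ εs →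
      ∀ α : (Fin 4 → Fin 4 → Fin 4 → ℤ × ℤ × ℤ → ℝ), InTableClass R α →
        ∀ W : ℤ → ℝ → Em 4, IsEternal ε₀ α W → EternalSurvivingFwd 1 ε₀ W → UniformBound W) :
    ∀ R : ℝ, 1 ≤ R → ∃ εs : ℝ, 0 < εs ∧ ∀ ε₀ : ℝ, 0 < ε₀ → ε₀ ≤ εs →
      ∀ α : (Fin 4 → Fin 4 → Fin 4 → ℤ × ℤ × ℤ → ℝ), InTableClass R α →
        (∃ W : ℤ → ℝ → Em 4, IsEternal ε₀ α W ∧ EternalSurvivingFwd 1 ε₀ W) →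
          ∃ (q : ℕ) (π : Equiv.Perm (Fin q)) (T : ℝ) (Φ : Fin q → ℝ → Em 4),
            IsDSSWave ε₀ α π T Φ ∧ Surviving 1 ε₀ T ∧ ∃ r x, Φ r x ≠ 0 :=
  stubEternalIsDSS_of_noSurvivingEternalFwdOne
    fun R hR => noSurvivingEternalFwd_of_bdd_of_typeIApriori (h0 R hR) (hI R hR)

/-- **THE SKELETON PINNED BEHIND EXISTING ITEMS.** Both registered stubs of skeleton `9d85f4d387c689cd`
(signatures verbatim: `stub_eternalFromBlowup`, then `stub_eternalIsDSS`) follow from the route's `Target`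
(stmt-NavierStokesRegularity-20204; it gives the extraction stub vacuously, `stubEternalFromBlowup_of_target`),
the bounded inviscid Liouville item `NoSurvivingEternalBddOne` (stmt-…-20451) and the type-I a-priori bound
for forward-surviving admissible eternal solutions (spelled inline; the one analytic gap, no item).
[cite: Tao2016AveragedNS, §4 Thm. 4.2 (statement shape), §6.4; cell vocabulary] -/
theorem stubs_of_target_of_noSurvivingEternalBddOne_of_typeIApriori (hT : Target)
    (h0 : NoSurvivingEternalBddOne)
    (hI : ∀ R : ℝ, 1 ≤ R → ∃ εs : ℝ, 0 < εs ∧ ∀ ε₀ : ℝ, 0 < ε₀ → ε₀ ≤ εs →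
      ∀ α : (Fin 4 → Fin 4 → Fin 4 → ℤ × ℤ × ℤ → ℝ), InTableClass R α →
        ∀ W : ℤ → ℝ → Em 4, IsEternal ε₀ α W → EternalSurvivingFwd 1 ε₀ W → UniformBound W) :
    (∀ R : ℝ, 1 ≤ R → ∃ εs : ℝ, 0 < εs ∧ ∀ ε₀ : ℝ, 0 < ε₀ → ε₀ ≤ εs →
      ∀ (α : (Fin 4 → Fin 4 → Fin 4 → ℤ × ℤ × ℤ → ℝ)) (X₀ : Fin 4 → ℝ),
        InTableClass R α → NoGlobalCascade ε₀ α X₀ →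
          ∃ W : ℤ → ℝ → Em 4, IsEternal ε₀ α W ∧ EternalSurvivingFwd 1 ε₀ W) ∧
    (∀ R : ℝ, 1 ≤ R → ∃ εs : ℝ, 0 < εs ∧ ∀ ε₀ : ℝ, 0 < ε₀ → ε₀ ≤ εs →
      ∀ α : (Fin 4 → Fin 4 → Fin 4 → ℤ × ℤ × ℤ → ℝ), InTableClass R α →
        (∃ W : ℤ → ℝ → Em 4, IsEternal ε₀ α W ∧ EternalSurvivingFwd 1 ε₀ W) →
          ∃ (q : ℕ) (π : Equiv.Perm (Fin q)) (T : ℝ) (Φ : Fin q → ℝ → Em 4),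
            IsDSSWave ε₀ α π T Φ ∧ Surviving 1 ε₀ T ∧ ∃ r x, Φ r x ≠ 0) :=
  ⟨stubEternalFromBlowup_of_target hT, stubEternalIsDSS_of_noSurvivingEternalBddOne_of_typeIApriori h0 hI⟩

/-- **The classification stub in «Liouville-upgrade» normal form.** `stub_eternalIsDSS` (left side,
signature verbatim) is EQUIVALENT to: below a threshold, on every `E₂(R)` table on which every
(S₁)-surviving admissible DSS wave is trivial (K1(1) at `(α, ε₀)`), no admissible eternal solution is
forward (S₁)-surviving (K1^∞_fwd(1) at `(α, ε₀)`) — pointwise contraposition of the `∃→∃` classification.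
[cite: Tao2016AveragedNS, §4 Thm. 4.2 (statement shape), §6.4; cell vocabulary] -/
theorem stubEternalIsDSS_iff_liouvilleUpgrade :
    (∀ R : ℝ, 1 ≤ R → ∃ εs : ℝ, 0 < εs ∧ ∀ ε₀ : ℝ, 0 < ε₀ → ε₀ ≤ εs →
      ∀ α : (Fin 4 → Fin 4 → Fin 4 → ℤ × ℤ × ℤ → ℝ), InTableClass R α →
        (∃ W : ℤ → ℝ → Em 4, IsEternal ε₀ α W ∧ EternalSurvivingFwd 1 ε₀ W) →
          ∃ (q : ℕ) (π : Equiv.Perm (Fin q)) (T : ℝ) (Φ : Fin q → ℝ → Em 4),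
            IsDSSWave ε₀ α π T Φ ∧ Surviving 1 ε₀ T ∧ ∃ r x, Φ r x ≠ 0) ↔
    (∀ R : ℝ, 1 ≤ R → ∃ εs : ℝ, 0 < εs ∧ ∀ ε₀ : ℝ, 0 < ε₀ → ε₀ ≤ εs →
      ∀ α : (Fin 4 → Fin 4 → Fin 4 → ℤ × ℤ × ℤ → ℝ), InTableClass R α →
        (∀ (q : ℕ) (π : Equiv.Perm (Fin q)) (T : ℝ) (Φ : Fin q → ℝ → Em 4),
            IsDSSWave ε₀ α π T Φ → Surviving 1 ε₀ T → ∀ r x, Φ r x = 0) →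
          ∀ W : ℤ → ℝ → Em 4, IsEternal ε₀ α W → ¬ EternalSurvivingFwd 1 ε₀ W) := by
  refine forall_congr' fun R => forall_congr' fun _ => exists_congr fun εs => and_congr_right fun _ =>
    forall_congr' fun ε₀ => forall_congr' fun _ => forall_congr' fun _ => forall_congr' fun α =>
    forall_congr' fun _ => ?_
  constructor
  · intro h hK1 W hW hS
    obtain ⟨q, π, T, Φ, hD, hSv, r, x, hne⟩ := h ⟨W, hW, hS⟩
    exact hne (hK1 q π T Φ hD hSv r x)
  · intro h hW
    by_contra hno
    obtain ⟨W, hE, hS⟩ := hW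
    refine h (fun q π T Φ hD hSv r x => ?_) W hE hS
    by_contra hne
    exact hno ⟨q, π, T, Φ, hD, hSv, r, x, hne⟩

/-- **The classification stub UPGRADES K1(1) to K1^∞_fwd(1).** `stub_eternalIsDSS` (verbatim) and the
rev-1 aside `NoSurvivingDSSOne` (stmt-NavierStokesRegularity-20205: no non-trivial (S₁)-surviving
admissible DSS wave below a threshold) give, for every spread `R ≥ 1`, the unrestricted inviscid Liouville
predicate `NoSurvivingEternalFwd R 1` (thresholds by `min`).
[cite: Tao2016AveragedNS, §4 Thm. 4.2 (statement shape), §6.4; cell vocabulary] -/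
theorem noSurvivingEternalFwdOne_of_stubEternalIsDSS_of_noSurvivingDSSOne
    (hDSS : ∀ R : ℝ, 1 ≤ R → ∃ εs : ℝ, 0 < εs ∧ ∀ ε₀ : ℝ, 0 < ε₀ → ε₀ ≤ εs →
      ∀ α : (Fin 4 → Fin 4 → Fin 4 → ℤ × ℤ × ℤ → ℝ), InTableClass R α →
        (∃ W : ℤ → ℝ → Em 4, IsEternal ε₀ α W ∧ EternalSurvivingFwd 1 ε₀ W) →
          ∃ (q : ℕ) (π : Equiv.Perm (Fin q)) (T : ℝ) (Φ : Fin q → ℝ → Em 4),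
            IsDSSWave ε₀ α π T Φ ∧ Surviving 1 ε₀ T ∧ ∃ r x, Φ r x ≠ 0)
    (hK1 : NoSurvivingDSSOne) : ∀ R : ℝ, 1 ≤ R → NoSurvivingEternalFwd R 1 := by
  intro R hR
  obtain ⟨ε₁, hε₁, H1⟩ := stubEternalIsDSS_iff_liouvilleUpgrade.1 hDSS R hR
  obtain ⟨ε₂, hε₂, H2⟩ := hK1 R hR
  refine ⟨min ε₁ ε₂, lt_min hε₁ hε₂, fun ε₀ hε₀ hle α hα W hW => ?_⟩
  exact H1 ε₀ hε₀ (hle.trans (min_le_left _ _)) α hα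
    (H2 ε₀ hε₀ (hle.trans (min_le_right _ _)) α hα) W hW

/-- **The historical `Assembly` one level down.** The two registered stubs and the rev-1 aside K1(1)
`NoSurvivingDSSOne` give the route's `Target` DIRECTLY through the eternal-solution glue
`noRobustBlowupBelow_of_eternalFwd` (K1^∞_fwd(1) ∧ K2^∞_fwd(1) ⇒ no robust blow-up below the threshold),
without assembling the crux `BlowupRigidityOne` first.
[cite: Tao2016AveragedNS, §4 Thm. 4.2 (statement shape), §6.4; cell vocabulary] -/
theorem target_of_stubs_of_noSurvivingDSSOne
    (hFrom : ∀ R : ℝ, 1 ≤ R → ∃ εs : ℝ, 0 < εs ∧ ∀ ε₀ : ℝ, 0 < ε₀ → ε₀ ≤ εs →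
      ∀ (α : (Fin 4 → Fin 4 → Fin 4 → ℤ × ℤ × ℤ → ℝ)) (X₀ : Fin 4 → ℝ),
        InTableClass R α → NoGlobalCascade ε₀ α X₀ →
          ∃ W : ℤ → ℝ → Em 4, IsEternal ε₀ α W ∧ EternalSurvivingFwd 1 ε₀ W)
    (hDSS : ∀ R : ℝ, 1 ≤ R → ∃ εs : ℝ, 0 < εs ∧ ∀ ε₀ : ℝ, 0 < ε₀ → ε₀ ≤ εs →
      ∀ α : (Fin 4 → Fin 4 → Fin 4 → ℤ × ℤ × ℤ → ℝ), InTableClass R α →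
        (∃ W : ℤ → ℝ → Em 4, IsEternal ε₀ α W ∧ EternalSurvivingFwd 1 ε₀ W) →
          ∃ (q : ℕ) (π : Equiv.Perm (Fin q)) (T : ℝ) (Φ : Fin q → ℝ → Em 4),
            IsDSSWave ε₀ α π T Φ ∧ Surviving 1 ε₀ T ∧ ∃ r x, Φ r x ≠ 0)
    (hK1 : NoSurvivingDSSOne) : Target :=
  target_of_stubEternalFromBlowup_of_noSurvivingEternalFwdOne hFrom
    (noSurvivingEternalFwdOne_of_stubEternalIsDSS_of_noSurvivingDSSOne hDSS hK1)

end BlowupRigidityOne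

end Summit.NavierStokesRegularity.NavierStokesRegularity.Theorems

end
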